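import Literature.RingTheory.Localization.FinitePresentationDescent
import Mathlib.RingTheory.FiniteType
import Mathlib.Algebra.MvPolynomial.Eval
import HarnessLib

/-!
# Finitely generated algebras over a field are base changes of finitely generated algebras over a finitely generated subring

Topic `Literature/RingTheory/Localization` (companion of `FinitePresentationDescent`, which treats
the localization diagram `A_S = colim A[1/s]`). The affine case of EGA IV₃ Thm. 8.8.2 (ii) / Stacks
01ZM for the diagram of finitely generated SUBRINGS of a field: **a finitely generated algebra `C`
over a field `K` is `K ⊗_{R₀} C₀` for a finitely generated subring `R₀ ⊆ K` and a finitely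
generated `R₀`-algebra `C₀`; if `C` is a domain, `C₀` may be taken to be a domain into which `R₀`
embeds** (`exists_fg_subalgebra_tensorProduct_algEquiv`). Write `C = K[X₁,…,Xₙ]/𝔓`, let `R₀` be
generated by the coefficients of finitely many generators of `𝔓`, and take `C₀ = R₀[X]/(𝔓 ∩ R₀[X])`,
the image of `R₀[X]` in `C`: then `(𝔓 ∩ R₀[X]) K[X] = 𝔓` because the generators of `𝔓` already lie in
`R₀[X]`, so `K ⊗_{R₀} C₀ = K[X]/𝔓 = C` (`Localization.nonempty_tensorProduct_quotient_algEquiv`). This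
is the "spreading out over a finitely generated `ℤ`-algebra" of a complex affine variety (Serre;
Maulik–Poonen 2012, §4), in algebra form.

## References

* [EGAIV3] A. Grothendieck, J. Dieudonné, EGA IV₃, Thm. 8.8.2 (ii).
* [StacksProject] The Stacks Project, Tag 01ZM.
* [MaulikPoonen2012] D. Maulik, B. Poonen, Néron–Severi groups under specialization, Duke Math.
  J. 161 (2012), §4.
-/

noncomputable section

universe u

open TensorProduct

namespace Literature.RingTheory.Localization

/-- **A finitely generated algebra over a field is the base change of a finitely generated algebra
over a finitely generated subring** (affine case of EGA IV₃ 8.8.2 (ii) / Stacks 01ZM for the system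
of finitely generated subrings of `K`). For `C` of finite type over the field `K` there are a
finitely generated `ℤ`-subalgebra `R₀ ⊆ K` and an `R₀`-algebra `C₀` of finite type, which is a DOMAIN
if `C` is and into which `R₀` maps injectively if `C ≠ 0`, with `K ⊗_{R₀} C₀ ≃ₐ[K] C`. Construction:
`C = K[X]/𝔓`, `R₀ = ℤ[coefficients of generators of 𝔓]`, `C₀ = R₀[X]/(𝔓 ∩ R₀[X])`.
[cite: StacksProject, Tag 01ZM (affine case)] [cite: EGAIV3, Thm. 8.8.2 (ii)] -/
theorem exists_fg_subalgebra_tensorProduct_algEquiv {K : Type u} [Field K] (C : Type u)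
    [CommRing C] [Algebra K C] [Algebra.FiniteType K C] :
    ∃ (R₀ : Subalgebra ℤ K) (C₀ : Type u) (_ : CommRing C₀) (_ : Algebra R₀ C₀),
      R₀.FG ∧ Algebra.FiniteType R₀ C₀ ∧ (IsDomain C → IsDomain C₀) ∧
      (Nontrivial C → Function.Injective (algebraMap R₀ C₀)) ∧
      Nonempty (K ⊗[R₀] C₀ ≃ₐ[K] C) := by
  classical
  -- a presentation `C = K[X₁,…,Xₙ]/𝔓` with finitely many generators `T` of `𝔓`
  obtain ⟨n, f, hf⟩ := Algebra.FiniteType.iff_quotient_mvPolynomial''.1 ‹Algebra.FiniteType K C›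
  obtain ⟨T, hT⟩ := (inferInstance : IsNoetherian (MvPolynomial (Fin n) K) (MvPolynomial (Fin n) K)).noetherian
    (RingHom.ker f.toRingHom)
  -- the subring generated by the coefficients of the generators
  let R₀ : Subalgebra ℤ K := Algebra.adjoin ℤ (↑(T.biUnion fun p => p.coeffs) : Set K)
  have hR₀fg : R₀.FG := Subalgebra.fg_adjoin_finset _
  -- every generator lifts to `R₀[X]`
  have hlift : ∀ p ∈ T, ∃ p' : MvPolynomial (Fin n) R₀,
      MvPolynomial.map (algebraMap R₀ K) p' = p := by
    intro p hp
    have h : p ∈ Set.range (MvPolynomial.map (algebraMap R₀ K)) := by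
      refine MvPolynomial.mem_range_map_iff_coeffs_subset.2 fun c hc => ?_
      have hc' : c ∈ (↑(T.biUnion fun p => p.coeffs) : Set K) := by
        rw [Finset.coe_biUnion]
        exact Set.mem_biUnion hp hc
      refine ⟨⟨c, Algebra.subset_adjoin hc'⟩, rfl⟩
    obtain ⟨p', hp'⟩ := h
    exact ⟨p', hp'⟩
  -- the model `C₀ = R₀[X]/(𝔓 ∩ R₀[X])`
  let I₀ : Ideal (MvPolynomial (Fin n) R₀) :=
    RingHom.ker (f.toRingHom.comp (MvPolynomial.map (algebraMap R₀ K)))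
  refine ⟨R₀, MvPolynomial (Fin n) R₀ ⧸ I₀, inferInstance, inferInstance, hR₀fg, ?_, ?_, ?_, ?_⟩
  · -- finite type
    exact Algebra.FiniteType.of_surjective (Ideal.Quotient.mkₐ R₀ I₀) Ideal.Quotient.mk_surjective
  · -- domain
    intro hC
    haveI : I₀.IsPrime := RingHom.ker_isPrime _
    exact Ideal.Quotient.isDomain I₀
  · -- `R₀ → C₀` is injective
    intro hC r r' h
    apply Subtype.ext
    apply (algebraMap K C).injective
    have h1 : (Ideal.Quotient.mk I₀ (MvPolynomial.C r) : MvPolynomial (Fin n) R₀ ⧸ I₀) =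
        Ideal.Quotient.mk I₀ (MvPolynomial.C r') := h
    rw [Ideal.Quotient.eq, RingHom.mem_ker] at h1
    have h2 : f (MvPolynomial.map (algebraMap R₀ K) (MvPolynomial.C r - MvPolynomial.C r')) = 0 := h1
    rw [map_sub, MvPolynomial.map_C, MvPolynomial.map_C, map_sub, MvPolynomial.algHom_C,
      MvPolynomial.algHom_C, sub_eq_zero] at h2
    exact h2
  · -- `K ⊗ C₀ ≃ C`
    refine nonempty_tensorProduct_quotient_algEquiv I₀ f hf (fun q hq => hq) ?_
    have hT' : RingHom.ker f.toRingHom = Ideal.span (T : Set (MvPolynomial (Fin n) K)) := hT.symm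
    rw [hT']
    refine Ideal.span_le.2 fun p hp => ?_
    obtain ⟨p', hp'⟩ := hlift p hp
    have hp'I : p' ∈ I₀ := by
      change f (MvPolynomial.map (algebraMap R₀ K) p') = 0
      rw [hp']
      have : p ∈ RingHom.ker f.toRingHom := hT' ▸ Ideal.subset_span hp
      exact this
    rw [SetLike.mem_coe, ← hp']
    exact Ideal.mem_map_of_mem _ hp'I

end Literature.RingTheory.Localization

end
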